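import Summits.CriticalPhenomena.SAWScalingLimit.Theses.SAWWeldingIdentification
import Summits.CriticalPhenomena.SAWScalingLimit.Theses.SAWLoopFugacityFlow
import Summits.CriticalPhenomena.SAWScalingLimit.Theorems.SAWWeldingIdentificationWeldingLawOfLimitReductions
import Summits.CriticalPhenomena.SAWScalingLimit.Theorems.SAWWeldingIdentificationLimitUpgrade
import Summits.CriticalPhenomena.SAWScalingLimit.Theorems.SAWWeldingIdentificationRemovableLimitS1IsSimpleSubseqLimits
import HarnessLib

/-!
# Crux `RemovableLimit` (stmt-CriticalPhenomena-4503) is IDLE in route `SAWWeldingIdentification`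

Route `SAWWeldingIdentification` of `CriticalPhenomena/SAWScalingLimit` identifies every
subsequential weak limit `P` of the critical `δℤ²` SAW laws with the chordal SLE₈/₃ law by the LAW
OF ITS CONFORMAL WELDING: `closes : WeldingLawOfLimit → RemovableLimit → EventualTight →
(six supports) → SAWScalingLimit`. The crux (R) `RemovableLimit` (rank 3, XL / research-open:
`P`-a.s. the limit curve is a SIMPLE CHORD that is CONFORMALLY REMOVABLE inside `Ω`) enters
`closes` at exactly one place — the Lusin–Souslin identification `IdentifyFromWelding`, which asks
BOTH measures to be carried by removable chords so that the welding vector is injective on a Borel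
`P`-conull set.

This file proves, sorry-free and with every support discharged by tree theorems, that the route
closes WITHOUT (R):

* `sawScalingLimit_of_weldingLawOfLimit_of_eventualTight :
    WeldingLawOfLimit → EventualTight → SAWScalingLimit`,

so that the open content of the route is `WeldingLawOfLimit` (stmt-4502) `∧ EventualTight`
(stmt-1372) alone, and stmt-4503 is not load-bearing here. Three observations make this work.

1. **(W) already forces chord support.** `WeldingLawOfLimit` quantifies over EVERY welding
   functional pinned on simple chords; two admissible functionals differing off the Borel set of
   simple chords have the same SLE marginals, so `P` gives no mass to non-chords (tree theorem
   `WeldingLawOfLimit.ae_isSimpleChord_of_weldingLawOfLimit`, the refuters' R1 strength note made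
   formal). This is the simplicity half of (R) (= the `Q.chord 0 2` instance of stmt-4982).
2. **Welding rigidity is one-sided.** The tree's `WeldingRigidity` (`weldingRigidity_proof`) needs
   only ONE of the two chords to be removable: if `γ` is a removable simple chord and `γ'` ANY
   simple chord with the same welding on `ℚ₊`, then `γ = γ'` (the glued map `Ω → Ω` is conformal
   off `γ`). Removability of SLE₈/₃ chords is the proved support `SLERemovableChord`.
3. **One-sided identification by disintegration** (`measure_eq_map_of_rigid`, this file; replaces
   the two-sided Lusin–Souslin item `IdentifyFromWelding`). Let `V` be the welding vector at
   positive rationals, `P` carried by the Borel set `S` of simple chords, `ν = ℙ ∘ Γ⁻¹` the SLE law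
   with `Γ ω` a removable simple chord a.s., and `V_* P = V_* ν`. Disintegrate the joint law of
   `(V γ, γ)` under `P` over its first marginal `λ = V_* P` (`Measure.condKernel` on the Polish
   curve space): `P = ∫ κ_v dλ(v)` with `κ_v (S ∩ V⁻¹{v}) = 1` for `λ`-a.e. `v`, a BOREL set of
   good `v`'s, hence (as `λ = (V ∘ Γ)_* ℙ`) for `ℙ`-a.e. `ω` at `v = V (Γ ω)`. By one-sided
   rigidity `S ∩ V⁻¹{V (Γ ω)} = {Γ ω}`, so `κ_{V(Γ ω)} = δ_{Γ ω}` a.s., and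
   `P A = ∫ κ_{V(Γ ω)}(A) dℙ = ℙ(Γ ∈ A) = ν A`. No Borel structure on the (co-analytic) set of
   removable chords is needed — the obstruction that forced the restatement `IdentifyFromWeldingAE`
   (stmt-11091) and that blocks the up-pin `SAWScalingLimit → RemovableLimit` does not arise.

Consequences recorded here: `isSLELaw_of_weldingLawOfLimit` ((W) alone identifies every
subsequential limit), `subseqIdentification_of_weldingLawOfLimit'` ((W) ⇒ stmt-0783, dropping the
hypothesis (R) of the tree's `subseqIdentification_of_weldingLawOfLimit`), and the closing chain
above. What is deliberately NOT here: any claim about `RemovableLimit` itself (it implies stmt-4982,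
`simpleSubseqLimits_of_removableLimit`, and stays research-open); this file only shows the route does
not need it.

References: Kechris, *Classical Descriptive Set Theory*, §17.F (disintegration); Billingsley
(1999) Thm. 5.1; Sheffield (2016) §1.4 (welding determines a removable curve); Jones–Smirnov (2000).
-/

noncomputable section

open MeasureTheory ProbabilityTheory Filter Topology Set
open scoped ENNReal NNReal
open Literature.Probability.RandomPlanarGeometry Literature.Probability.LatticeModels
open Literature.Probability.Process (preWienerMeasure)
open UpperHalfPlane (upperHalfPlaneSet)
open Summit.CriticalPhenomena.SAWScalingLimit.Theses

namespace Summit.CriticalPhenomena.SAWScalingLimit.Theorems.RemovableLimit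

/-! ### One-sided identification by disintegration (abstract form) -/

/-- A probability measure giving full mass to a (measurable) singleton is the Dirac mass.
[folklore] -/
theorem measure_eq_dirac_of_apply_singleton_eq_one {X : Type*} [MeasurableSpace X]
    [MeasurableSingletonClass X] {κ : Measure X} [IsProbabilityMeasure κ] {x₀ : X}
    (h : κ {x₀} = 1) : κ = Measure.dirac x₀ := by
  refine Measure.ext fun A hA => ?_
  rw [Measure.dirac_apply' _ hA]
  by_cases hx : x₀ ∈ A
  · rw [indicator_of_mem hx, Pi.one_apply]
    exact le_antisymm prob_le_one (h ▸ measure_mono (singleton_subset_iff.2 hx))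
  · rw [indicator_of_notMem hx]
    refine le_antisymm ?_ bot_le
    have hsub : A ⊆ {x₀}ᶜ := fun y hy hyx => hx (mem_singleton_iff.1 hyx ▸ hy)
    calc κ A ≤ κ {x₀}ᶜ := measure_mono hsub
      _ = 1 - κ {x₀} := prob_compl_eq_one_sub (measurableSet_singleton x₀)
      _ = 0 := by rw [h, tsub_self]

/-- **One-sided identification by disintegration.** Let `X` be standard Borel, `V : X → Y`
measurable into a space with measurable diagonal, `P` a probability measure on `X` carried by a
measurable set `S`, and `Γ : Ω → X` an a.e.-measurable random element (law `μ.map Γ`) which almost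
surely satisfies a property `R` (NOT assumed measurable) such that `R x → x ∈ S` and `V` separates
every `R`-point from every OTHER point of `S` (`R x → y ∈ S → V x = V y → x = y`). If the laws of
`V` under `P` and `μ.map Γ` agree, then `P = μ.map Γ`. Proof: disintegrate the joint law `ρ` of
`(V x, x)` under `P` over its first marginal `λ = P.map V` (`Measure.condKernel`, `X` standard
Borel): the conditional laws `κ_v` give full mass to the fibre `S ∩ V⁻¹{v}` for `λ`-a.e. `v` — a
measurable set of `v`'s, so also for `v = V (Γ ω)`, `μ`-a.e. `ω` (`λ = μ.map (V ∘ Γ)`); by the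
separation hypothesis that fibre is `{Γ ω}`, so `κ_{V (Γ ω)} = δ_{Γ ω}` a.s. and
`P A = ∫ κ_v A dλ = ∫ κ_{V(Γ ω)} A dμ = μ (Γ ⁻¹' A)`. [folklore] -/
theorem measure_eq_map_of_rigid {X : Type*} [MeasurableSpace X] [StandardBorelSpace X]
    {Y : Type*} [MeasurableSpace Y] [MeasurableEq Y] {Ω : Type*} [MeasurableSpace Ω]
    {P : Measure X} [IsProbabilityMeasure P] {μ : Measure Ω} [IsProbabilityMeasure μ]
    {Γ : Ω → X} (hΓ : AEMeasurable Γ μ) {V : X → Y} (hV : Measurable V)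
    {S : Set X} (hS : MeasurableSet S) (R : X → Prop)
    (hP : ∀ᵐ x ∂P, x ∈ S) (hμ : ∀ᵐ ω ∂μ, R (Γ ω)) (hRS : ∀ x, R x → x ∈ S)
    (hrig : ∀ x, R x → ∀ y ∈ S, V x = V y → x = y)
    (hlaw : P.map V = (μ.map Γ).map V) : P = μ.map Γ := by
  classical
  haveI : IsProbabilityMeasure (μ.map Γ) := Measure.isProbabilityMeasure_map hΓ
  haveI : Nonempty X := nonempty_of_isProbabilityMeasure P
  -- the joint law `ρ` of `(V x, x)` under `P`, its first marginal and its conditional kernel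
  have hVid : Measurable fun x : X => (V x, x) := hV.prodMk measurable_id
  set ρ : Measure (Y × X) := P.map fun x => (V x, x) with hρ
  haveI : IsProbabilityMeasure ρ := Measure.isProbabilityMeasure_map hVid.aemeasurable
  have hfst : ρ.fst = P.map V := by
    rw [Measure.fst, hρ, Measure.map_map measurable_fst hVid]
    rfl
  have hVΓ : AEMeasurable (V ∘ Γ) μ := hV.comp_aemeasurable hΓ
  have hfst' : ρ.fst = μ.map (V ∘ Γ) := by
    rw [hfst, hlaw, AEMeasurable.map_map_of_aemeasurable hV.aemeasurable hΓ]
  set κ : Kernel Y X := ρ.condKernel with hκ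
  have hdis : ρ.fst ⊗ₘ κ = ρ := ρ.disintegrate κ
  -- the fibre set `D = {(v, x) | V x = v, x ∈ S}` has full `ρ`-mass
  set D : Set (Y × X) := {p | V p.2 = p.1 ∧ p.2 ∈ S} with hD
  have hDm : MeasurableSet D :=
    (measurableSet_eq_fun (hV.comp measurable_snd) measurable_fst).inter (measurable_snd hS)
  have hρD : ρ D = 1 := by
    rw [hρ, Measure.map_apply hVid hDm]
    have hpre : (fun x => (V x, x)) ⁻¹' D = S := by
      ext x
      simp [hD]
    rw [hpre]
    exact (prob_compl_eq_zero_iff hS).1 (ae_iff.1 hP)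
  -- hence the conditional laws give full mass to the fibres, `ρ.fst`-a.e.
  have hfD : Measurable fun v => κ v (Prod.mk v ⁻¹' D) := Kernel.measurable_kernel_prodMk_left hDm
  have hintD : ∫⁻ v, κ v (Prod.mk v ⁻¹' D) ∂ρ.fst = 1 := by
    rw [← Measure.compProd_apply hDm, hdis, hρD]
  have haeD : ∀ᵐ v ∂ρ.fst, κ v (Prod.mk v ⁻¹' D) = 1 := by
    have hle : (fun v => κ v (Prod.mk v ⁻¹' D)) ≤ᵐ[ρ.fst] fun _ => 1 :=
      Eventually.of_forall fun v => prob_le_one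
    have h1 : ∫⁻ _v, (1 : ℝ≥0∞) ∂ρ.fst ≤ ∫⁻ v, κ v (Prod.mk v ⁻¹' D) ∂ρ.fst := by
      rw [hintD, lintegral_const, measure_univ, mul_one]
    have := ae_eq_of_ae_le_of_lintegral_le hle (by rw [hintD]; exact ENNReal.one_ne_top)
      measurable_const.aemeasurable h1
    exact this.mono fun v hv => hv
  -- transfer to `ω`: for `μ`-a.e. `ω` the conditional law at `V (Γ ω)` is the Dirac mass at `Γ ω`
  have haeω : ∀ᵐ ω ∂μ, κ (V (Γ ω)) (Prod.mk (V (Γ ω)) ⁻¹' D) = 1 := by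
    rw [hfst'] at haeD
    exact ae_of_ae_map hVΓ haeD
  have hdirac : ∀ᵐ ω ∂μ, κ (V (Γ ω)) = Measure.dirac (Γ ω) := by
    filter_upwards [haeω, hμ] with ω hω hR
    have hfib : Prod.mk (V (Γ ω)) ⁻¹' D = {Γ ω} := by
      ext x
      simp only [hD, mem_preimage, mem_setOf_eq, mem_singleton_iff]
      constructor
      · rintro ⟨hVx, hxS⟩
        exact (hrig (Γ ω) hR x hxS hVx.symm).symm
      · rintro rfl
        exact ⟨rfl, hRS _ hR⟩
    rw [hfib] at hω
    exact measure_eq_dirac_of_apply_singleton_eq_one hω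
  -- conclude: `P A = ∫ κ_v A dλ = ∫ κ_{V(Γ ω)} A dμ = μ (Γ ⁻¹' A)`
  refine Measure.ext fun A hA => ?_
  have hPA : P A = ρ (Prod.snd ⁻¹' A) := by
    rw [hρ, Measure.map_apply hVid (measurable_snd hA)]
    rfl
  have hκA : Measurable fun v => κ v A := Kernel.measurable_coe κ hA
  calc P A = ρ (Prod.snd ⁻¹' A) := hPA
    _ = ∫⁻ v, κ v (Prod.mk v ⁻¹' (Prod.snd ⁻¹' A)) ∂ρ.fst := by
        rw [← Measure.compProd_apply (measurable_snd hA), hdis]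
    _ = ∫⁻ v, κ v A ∂ρ.fst := by rfl
    _ = ∫⁻ ω, κ (V (Γ ω)) A ∂μ := by
        rw [hfst']
        exact lintegral_map' hκA.aemeasurable hVΓ
    _ = ∫⁻ ω, A.indicator 1 (Γ ω) ∂μ := by
        refine lintegral_congr_ae (hdirac.mono fun ω hω => ?_)
        simp only [hω, Measure.dirac_apply' _ hA]
    _ = ∫⁻ x, A.indicator 1 x ∂(μ.map Γ) :=
        (lintegral_map' (measurable_one.indicator hA).aemeasurable hΓ).symm
    _ = (μ.map Γ) A := lintegral_indicator_one hA

/-! ### One-sided identification from the welding law -/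

/-- **One-sided `IdentifyFromWelding`.** For a conformal rectangle `Q`, a welding functional `W`
(Borel in the chord at each `x`), a probability measure `P` on `CurveClass ℂ` carried by the SIMPLE
CHORDS of `(Ω; a, b) = Q.chord 0 2`, and a random curve `Γ` (a.e.-measurable, under a probability
measure `μ'`) almost surely satisfying a property `R` of simple chords such that the welding at
positive rationals separates every `R`-chord from every other simple chord: if all
finite-dimensional `W`-marginals of `P` and `μ'.map Γ` at positive rational points agree, then
`P = μ'.map Γ`. This is `measure_eq_map_of_rigid` for the welding vector
`γ ↦ (W Q γ q)_{q ∈ ℚ_{>0}}` (measurable into the Polish space `ℚ_{>0} → ℝ`), the Borel set of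
simple chords (`measurableSet_isSimpleChord`) and the equality of laws of the welding vector from
its finite-dimensional marginals (`IdentifyFromWelding.map_pi_eq_of_forall_fin_marginals_eq`).
Compared with the item `IdentifyFromWelding` (stmt-4507) / `IdentifyFromWeldingAE` (stmt-11091),
`P` is NOT assumed to be carried by removable chords. [folklore] -/
theorem identifyFromWelding_oneSided (Q : ConformalRectangle)
    (W : ConformalRectangle → CurveClass ℂ → ℝ → ℝ) (P : Measure (CurveClass ℂ))
    {Ω' : Type*} [MeasurableSpace Ω'] (μ' : Measure Ω') (Γ : Ω' → CurveClass ℂ)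
    [IsProbabilityMeasure P] [IsProbabilityMeasure μ'] (hΓ : AEMeasurable Γ μ')
    (hWmeas : ∀ x : ℝ, Measurable fun γ : CurveClass ℂ => W Q γ x)
    (hP : ∀ᵐ γ ∂P, (Q.chord 0 2 (by decide)).IsSimpleChord γ)
    (R : CurveClass ℂ → Prop) (hμ : ∀ᵐ ω ∂μ', R (Γ ω))
    (hRS : ∀ γ, R γ → (Q.chord 0 2 (by decide)).IsSimpleChord γ)
    (hrig : ∀ γ γ' : CurveClass ℂ, R γ → (Q.chord 0 2 (by decide)).IsSimpleChord γ' →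
      (∀ q : ℚ, 0 < q → W Q γ q = W Q γ' q) → γ = γ')
    (hmarg : ∀ (k : ℕ) (x : Fin k → ℚ), (∀ i, 0 < x i) →
      P.map (fun γ i => W Q γ (x i)) = (μ'.map Γ).map (fun γ i => W Q γ (x i))) :
    P = μ'.map Γ := by
  haveI : IsProbabilityMeasure (μ'.map Γ) := Measure.isProbabilityMeasure_map hΓ
  -- the welding vector at positive rationals
  let V : CurveClass ℂ → ({q : ℚ // 0 < q} → ℝ) := fun γ q => W Q γ ((q.1 : ℚ) : ℝ)
  have hV : Measurable V := measurable_pi_lambda _ fun q => hWmeas _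
  refine measure_eq_map_of_rigid (V := V) hΓ hV (measurableSet_isSimpleChord Q) R hP hμ hRS ?_ ?_
  · -- the welding separates `R`-chords from simple chords through its positive-rational values
    intro γ hγ γ' hγ' hVeq
    exact hrig γ γ' hγ hγ' fun q hq => congr_fun hVeq ⟨q, hq⟩
  · -- the laws of the welding vector agree: finite-dimensional marginals + π-system
    refine IdentifyFromWelding.map_pi_eq_of_forall_fin_marginals_eq (ν := μ'.map Γ)
      (fun (q : {q : ℚ // 0 < q}) (γ : CurveClass ℂ) => W Q γ ((q.1 : ℚ) : ℝ))
      (fun q => hWmeas _) fun k x => ?_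
    exact hmarg k (fun j => (x j).1) fun j => (x j).2

/-! ### (W) alone identifies every subsequential limit -/

/-- **`WeldingLawOfLimit` ALONE identifies every subsequential SAW limit with the SLE₈/₃ law**
(the core of the route's deciding theorem `closes` with BOTH `RemovableLimit` and tightness
removed): under `WeldingLawOfLimit`, every subsequential weak limit `P` of the critical SAW laws in
`(Q.chord 0 2; a_δ, b_δ)` along a positive sequence `δₙ → 0` is a chordal SLE₈/₃ law in `(Ω; a, b)`.
Ingredients, all proved in tree: an SLE curve `Γ` (`ChordalSLE83Exists_holds`); chord support of
`P` from (W) (`ae_isSimpleChord_of_weldingLawOfLimit`); the welding set-up (`WeldingSetup_proof`);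
ONE-SIDED rigidity (`weldingRigidity_proof`: only the first chord need be removable); removability
of SLE₈/₃ chords (`SLERemovableChord_proof`); and the one-sided identification
`identifyFromWelding_oneSided`. [folklore] -/
theorem isSLELaw_of_weldingLawOfLimit (hW : SAWWeldingIdentification.WeldingLawOfLimit)
    (Q : ConformalRectangle) (a b : ℝ → Site 2)
    (hab : SAW.IsEndpointApprox (Q.chord 0 2 (by decide)) a b)
    (P : Measure (CurveClass ℂ)) (hP : IsProbabilityMeasure P)
    (δs : ℕ → ℝ) (hpos : ∀ n, 0 < δs n) (hδ : Tendsto δs atTop (𝓝 0))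
    (hlim : ∀ f : BoundedContinuousFunction (CurveClass ℂ) ℝ,
      Tendsto (fun n => ∫ γ, f γ.curve ∂(SAW.law Q.carrier (δs n) (a (δs n)) (b (δs n))))
        atTop (𝓝 (∫ γ, f γ ∂P))) :
    IsSLELaw ((8 : NNReal) / 3) (Q.chord 0 2 (by decide)) P := by
  -- buildfix 2026-08-19: `ChordalSLE83Exists_holds` is no longer linked in the route file; cite the tree theorem it unfolded to.
  obtain ⟨Γ, hΓ⟩ := Literature.Probability.RandomPlanarGeometry.exists_isSLECurve_eightThirds (Q.chord 0 2 (by decide))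
  refine ⟨Γ, hΓ, ?_⟩
  haveI : IsProbabilityMeasure preWienerMeasure :=
    Literature.Probability.RandomPlanarGeometry.isProbabilityMeasure_preWienerMeasure'
  have hΓm : AEMeasurable Γ preWienerMeasure := hΓ.1
  obtain ⟨hsign, W, hWmeas, hWpin⟩ := WeldingSetup_proof
  obtain ⟨s, hs, hconf⟩ := hsign Q
  refine identifyFromWelding_oneSided Q W P preWienerMeasure Γ hΓm (hWmeas Q)
    (WeldingLawOfLimit.ae_isSimpleChord_of_weldingLawOfLimit hW Q a b hab P hP δs hpos hδ hlim)
    (fun γ => (γ ∈ CurveClass.simple ∧ γ.source = Q.pt 0 ∧ γ.target = Q.pt 2 ∧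
        γ.range ⊆ closure Q.carrier ∧ γ.range ∩ frontier Q.carrier ⊆ {Q.pt 0, Q.pt 2}) ∧
      (∀ F : ℂ → ℂ, ContinuousOn F Q.carrier → Set.InjOn F Q.carrier → F '' Q.carrier = Q.carrier →
        DifferentiableOn ℂ F (Q.carrier \ γ.range) → DifferentiableOn ℂ F Q.carrier))
    (SLERemovableChord_proof Q Γ hΓ) (fun γ hγ => hγ.1) ?_ ?_
  · -- ONE-SIDED rigidity: a removable simple chord and ANY simple chord with the same welding agree
    intro γ γ' hγ hγ' heq
    obtain ⟨L, R, φ, ψ, hb, hn⟩ := hconf γ hγ.1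
    obtain ⟨L', R', φ', ψ', hb', hn'⟩ := hconf γ' hγ'
    refine WeldingRigidity.weldingRigidity_proof Q γ γ' s L R L' R' φ ψ φ' ψ' (fun q => W Q γ q)
      hγ.1 hγ' hγ.2 hs hb hb' hn hn' ?_
    intro q hq
    have hq' : (0 : ℝ) < (q : ℝ) := by exact_mod_cast hq
    obtain ⟨hpos₁, hw₁⟩ := hWpin Q γ s L R φ ψ hγ.1 hs hb hn q hq'
    obtain ⟨-, hw₂⟩ := hWpin Q γ' s L' R' φ' ψ' hγ' hs hb' hn' q hq'
    refine ⟨hpos₁, hw₁, ?_⟩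
    rw [heq q hq]
    exact hw₂
  · -- the welding laws agree (W), at positive rational points
    intro k x hx
    exact hW IsSLECurve.map_eq_holds W hWpin hWmeas Q a b hab P hP δs hpos hδ hlim Γ hΓ k
      (fun i => (x i : ℝ)) (fun i => by exact_mod_cast hx i)

/-- **stmt-4502 ALONE ⇒ stmt-0783.** `WeldingLawOfLimit` implies the shared crux
`SubseqIdentification` (every subsequential weak limit of the critical SAW laws in a Dobrushin
domain is the chordal SLE₈/₃ law) — the tree's `subseqIdentification_of_weldingLawOfLimit` with its
hypothesis `RemovableLimit` dropped. Every Dobrushin domain `D` is `Q.chord 0 2` for a conformal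
rectangle `Q` (`exists_chord_eq`), and a sequence `sₙ → 0` within `(0, ∞)` is made positive by
changing finitely many terms, which changes neither the limit hypothesis nor the conclusion.
Together with `weldingLawOfLimit_of_subseqIdentification`: (W) ⟺ stmt-0783, unconditionally. [folklore] -/
theorem subseqIdentification_of_weldingLawOfLimit' :
    SAWWeldingIdentification.WeldingLawOfLimit → SAWLoopFugacityFlow.SubseqIdentification := by
  -- adapted from `WeldingLawOfLimit.subseqIdentification_of_weldingLawOfLimit`
  -- (Theorems/SAWWeldingIdentificationWeldingLawOfLimitReductions.lean), hypothesis (R) removed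
  intro hW D a b hab s μ hs hμ hlim
  obtain ⟨Q, rfl⟩ := exists_chord_eq D
  -- make the mesh sequence positive (it is eventually positive)
  have hev : ∀ᶠ n in atTop, 0 < s n := hs.eventually (eventually_mem_nhdsWithin)
  set s' : ℕ → ℝ := fun n => if 0 < s n then s n else 1 with hs'
  have hs'pos : ∀ n, 0 < s' n := fun n => by
    by_cases hn : 0 < s n
    · simp only [hs', if_pos hn]; exact hn
    · simp only [hs', if_neg hn]; exact one_pos
  have heq : ∀ᶠ n in atTop, s' n = s n := hev.mono fun n hn => if_pos hn
  have hs'0 : Tendsto s' atTop (𝓝 0) :=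
    (tendsto_nhdsWithin_iff.1 hs).1.congr' (heq.mono fun n hn => hn.symm)
  have key : ∀ f : BoundedContinuousFunction (CurveClass ℂ) ℝ,
      (fun n => ∫ γ, f γ.curve ∂(SAW.law Q.carrier (s n) (a (s n)) (b (s n)))) =ᶠ[atTop]
        fun n => ∫ γ, f γ.curve ∂(SAW.law Q.carrier (s' n) (a (s' n)) (b (s' n))) := fun f =>
    heq.mono fun n hn =>
      congrArg (fun δ : ℝ => ∫ γ, f γ.curve ∂(SAW.law Q.carrier δ (a δ) (b δ))) hn.symm
  have hlim' : ∀ f : BoundedContinuousFunction (CurveClass ℂ) ℝ,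
      Tendsto (fun n => ∫ γ, f γ.curve ∂(SAW.law Q.carrier (s' n) (a (s' n)) (b (s' n))))
        atTop (𝓝 (∫ γ, f γ ∂μ)) := fun f => (hlim f).congr' (key f)
  exact isSLELaw_of_weldingLawOfLimit hW Q a b hab μ hμ s' hs'pos hs'0 hlim'

/-- **(W) ⟺ stmt-0783, unconditionally** (`subseqIdentification_of_weldingLawOfLimit'` and the
tree's `weldingLawOfLimit_of_subseqIdentification`). [folklore] -/
theorem weldingLawOfLimit_iff_subseqIdentification :
    SAWWeldingIdentification.WeldingLawOfLimit ↔ SAWLoopFugacityFlow.SubseqIdentification :=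
  ⟨subseqIdentification_of_weldingLawOfLimit',
    WeldingLawOfLimit.weldingLawOfLimit_of_subseqIdentification⟩

/-! ### The route closes without `RemovableLimit` -/

/-- **The deciding chain of route `SAWWeldingIdentification` WITHOUT the crux `RemovableLimit`**
(and with every support item discharged by its tree proof): `WeldingLawOfLimit → EventualTight →
SAWScalingLimit`. Proof = the route's `closes` with Step 2 replaced: complete `D` to a conformal
rectangle `Q` (`exists_chord_eq`); take a chordal SLE₈/₃ curve `Γ` in `D`
(`ChordalSLE83Exists_holds`) and `μ = ℙ ∘ Γ⁻¹`; every subsequential weak limit `P` is an SLE₈/₃ law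
by `isSLELaw_of_weldingLawOfLimit`, hence equals `μ` by uniqueness in law
(`IsSLECurve.map_eq_holds`); eventual tightness upgrades this to convergence in law
(`limitUpgrade_proof`), i.e. `ConvergesInLawToSLE (8/3) D`. Hence stmt-CriticalPhenomena-4503 is not
load-bearing in this route: its open content is stmt-4502 ∧ stmt-1372. [folklore] -/
theorem sawScalingLimit_of_weldingLawOfLimit_of_eventualTight :
    Summit.CriticalPhenomena.SAWScalingLimit.Theses.SAWWeldingIdentification.WeldingLawOfLimit →
      Summit.CriticalPhenomena.SAWScalingLimit.Theses.SAWWeldingIdentification.EventualTight →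
      _root_.SAWScalingLimit := by
  -- adapted from `Summit.CriticalPhenomena.SAWScalingLimit.Theses.SAWWeldingIdentification.closes`
  intro hW hT D a b hab
  obtain ⟨Q, rfl⟩ := exists_chord_eq D
  -- Step 1. The chordal SLE_{8/3} random curve `Γ` in `D` and its law `μ = ℙ ∘ Γ⁻¹`.
  -- buildfix 2026-08-19: `ChordalSLE83Exists_holds` is no longer linked in the route file; cite the tree theorem it unfolded to.
  obtain ⟨Γ, hΓ⟩ := Literature.Probability.RandomPlanarGeometry.exists_isSLECurve_eightThirds (Q.chord 0 2 (by decide))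
  haveI : IsProbabilityMeasure preWienerMeasure :=
    Literature.Probability.RandomPlanarGeometry.isProbabilityMeasure_preWienerMeasure'
  have hΓm : AEMeasurable Γ preWienerMeasure := hΓ.1
  have hμ : IsProbabilityMeasure (preWienerMeasure.map Γ) := Measure.isProbabilityMeasure_map hΓm
  -- Step 2. Eventual tightness + "every subsequential weak limit is `μ`" ⇒ convergence in law.
  have hconv : TendstoLaw
      (fun δ (γ : SAW.DomainSAW (Q.chord 0 2 (by decide)).carrier δ (a δ) (b δ)) => γ.curve)
      (fun δ => SAW.law (Q.chord 0 2 (by decide)).carrier δ (a δ) (b δ))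
      id (preWienerMeasure.map Γ) := by
    refine limitUpgrade_proof (Q.chord 0 2 (by decide)) a b hab (hT _ a b hab) _ hμ ?_
    intro P hP δs hpos hδ hlim
    obtain ⟨Γ₀, hΓ₀, hPΓ₀⟩ := isSLELaw_of_weldingLawOfLimit hW Q a b hab P hP δs hpos hδ hlim
    rw [hPΓ₀]
    exact IsSLECurve.map_eq_holds hΓ₀ hΓ
  -- Step 3. Convergence in law to `μ = ℙ ∘ Γ⁻¹` is convergence in law to the random curve `Γ`.
  refine ⟨Γ, hΓ, Filter.Eventually.of_forall fun δ => SAW.aemeasurable_curve _ _ _ _, fun f => ?_⟩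
  have h := hconv f
  simp only [id] at h
  rw [MeasureTheory.integral_map hΓm f.continuous.aestronglyMeasurable] at h
  exact h

/-- **Corollary: the route's assembly statement with (R) struck out.** In the item graph of
`SAWWeldingIdentification`, `RemovableLimit` (stmt-4503) is implied-idle: the conclusion of the
deciding theorem follows from the other two cruxes. Stated in the shape of the route's `Assembly`
so a planner can re-close the route on `WeldingLawOfLimit`, `EventualTight` alone. [folklore] -/
theorem assembly_without_removableLimit :
    SAWWeldingIdentification.WeldingLawOfLimit → SAWWeldingIdentification.EventualTight →
      SAWWeldingIdentification.WeldingSetup → SAWWeldingIdentification.WeldingRigidity →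
      SAWWeldingIdentification.SLERemovableChord → SAWWeldingIdentification.IdentifyFromWelding →
      SAWWeldingIdentification.LimitUpgrade → SAWWeldingIdentification.ChordalSLE83Exists →
      _root_.SAWScalingLimit :=
  fun hW hT _ _ _ _ _ _ => sawScalingLimit_of_weldingLawOfLimit_of_eventualTight hW hT

end Summit.CriticalPhenomena.SAWScalingLimit.Theorems.RemovableLimit

end
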